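import Summits.QuantumFields.BalabanUV.Beta.RowD1JointEndSymWardTablesAn1
import Summits.QuantumFields.BalabanUV.Beta.SpineRecursiveWEndSymTables

/-!
# `BalabanUV.Beta.RowD1JointEndSymReflTablesAn1` — binder row D1: **THE LITERAL ROOT AT an1's FIRST-ORDER SYM TABLES WITH THE SECOND-ORDER hR LETTER
# (Wr-conj-c) DISCHARGED MODULO TABLE-LEVEL SECOND-ORDER LETTERS** — the root of record `RowD1JointEndSymWardTablesAn1` (p273819) with its hypotheses
# `X₂`, `Wc`, `hX₂`, `hWc`, `hWrC` SUPPLIED by (N7d-ii) `SpineRooted.WrecOf_brefC_of_tableLetters_sym` (`X₂ := diagK X2s`, `Wc := Rm` = the W-remainder),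
# i.e. REPLACED by: (h0) the level-0 second-order reflection letter, (hM2) the mixed letter ∀ j, (W-0B) the border letter ∀ j+1 against `bhKStepSh 3 Lc (Dsh Lc) (j+1)`,
# the mechanical split identities (hsplit) + localisations (hDg)(hX2L)(hΔL), the remainder recursion (hR2succ) carrying the four inner SANDWICH-DEFECT words
# (chart (II)), (hB0), the second units lock — and `hcomp` now stated AT `Wc := Rm_j` (the (N8) object)
# (β sub-cell, BINDER-OWNERS row D1 OWNER `b2b-balaban-beta-an2`, gen 31; brick (N7e); memo `gen31/JSB12SYM-SPINE.v1.8.md` §11)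

HONEST FRAMING (cell charter, verbatim): «discharging BetaPertH makes Bałaban's UV stability UNCONDITIONAL — a real constructive-QFT result; it is
NOT the continuum limit and NOT the Clay problem.»  HONEST DEPENDENCY: continuum YM on T⁴ ⇐ BetaPertH ∧ nine spine estimates (0/9 proved);
BetaPertH ⇐ (D1) ∧ (D4) ∧ CAP+tail; G-an2-4 gates asym, D1 and NE2/3/4.
DERIVED cell leaf ([folklore] wiring BY NAME).  No statement of Bałaban's papers, no `[cite:]`, no `Prop` fact, no `def`.  EVERY hypothesis below is a displayed
BINDER.  WHAT CHANGED against p273819: the hR side no longer displays a law about the literal's `W` (`hWrC` with free `X₂`, `Wc`): it displays second-order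
TABLE letters (about `vh₂S`, `mixFF`, the Wilson bi-table at level 0) + mechanical split identities + the remainder recursion, exactly as the hW side does since
gen 29 (N4); the compensator is IDENTIFIED (`Wc := Rm_j := ½•conjV 𝕄_j (diagK (X2s_jᵀ − X2s_j)) + ½•(Δ_j + Δ_jᵀ)`) and `hcomp` is the concrete identity at it.
WHAT REMAINS DISPLAYED: `2 ≤ N`; hW = (T2-B)×4 + (T2-M₂) with `RB RB″ RM` (an1 S2b); hR = (V-r)×3 (H-r) about an1's concrete tables (an1 S2c) + the
second-order table reflection letters (h0)(hM2)(W-0B) + (hsplit)(hDg)(hX2L)(hΔL)(hR2succ)(hB0)(hlock2) + `hcomp`-at-`Rm`; D1Tel, D1Rep, the printed B5 facts,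
the window.  HONEST: composition by name; root-level classes 0∕5 (cap-ref #112's quote stands; the hR class is now TABLE-LEVEL at second order too); tables in
tree: first order 3∕3, second order 0∕2; NOT D1, NOT `BetaPertH`, NOT continuum, NOT Clay.
Provenance: β sub-cell, unit beta-an2 gen 31, 2026-08-21 (v1); over `RowD1JointEndSymWardTablesAn1` (p273819) and `SpineRecursiveWEndSymTables` BY NAME;
no existing file touched.
-/

noncomputable section

open Finset
open scoped BigOperators
open Literature.Probability.LatticeModels (Torus.proj)
open Literature.MathematicalPhysics.QuantumFieldTheory
open Literature.MathematicalPhysics.QuantumFieldTheory.Balaban1983to89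
open Literature.MathematicalPhysics.QuantumFieldTheory.Balaban1983to89.Beta
open Literature.MathematicalPhysics.QuantumFieldTheory.Balaban1983to89.Beta.VectorTailsLoc (fam kfam)
open Literature.MathematicalPhysics.QuantumFieldTheory.Balaban1983to89.Beta.VectorLegVolumeAdapter (MvE)
open ExpKernelCalculus (MKer BiLoc VertexFamily comp tr tadpole shiftK)
open PolarizationSign (reflSign WardTransversal AxisReflectionCovariant)
open KernelReflection (refK)
open ResolventReflection (bref Φ)
open AffineAveraging (box toSite)
open AveragingContoursRooted (ctr ctrOff ctrOff_mem_box)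
open OneStepResolventKernel (Fib LocStencil JetData)
open OneStepKernelFamily (KInvStep colH vertexOfK TbalOf flipK D1Tel D1Rep D1Drift)
open KernelWard (divV divW)
open StepJetData (mfNeg wilsonA)
open BalabanStepJetsSucc (mmRead wE wVH)
open SecondOrderResponse (dM W2OfK LocStencilFM)
open BalabanCompositeJets (LocStencil₂)
open BalabanStepW2 (M2Of wB2 wV4)
open WilsonBiStencil (wilsonW₂)
open WilsonVertex2Sym (wsym22)
open Summit.QuantumFields.BalabanUV.Beta.TameKernelCalculus
open Summit.QuantumFields.BalabanUV.Beta.ChartConjugation (conjV conjW)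
open Summit.QuantumFields.BalabanUV.Beta.ChartConjugationDefectEnd (conjDefect sandwichDefect)
open Summit.QuantumFields.BalabanUV.Beta.AxialDressingRooted (one_le_of_neZero)
open Summit.QuantumFields.BalabanUV.Beta.SymmetrisedDressingKernel (coDressKSymAt)
open Summit.QuantumFields.BalabanUV.Beta.AveragingWardRootedStencils (legInd)
open Summit.QuantumFields.BalabanUV.Beta.SymmetrisedStepJets (SymTables Gsym SsymOf SpureSymOf JsB12Sym0 JsB12Sym)
open Summit.QuantumFields.BalabanUV.Beta.SpineRooted (M1Of SpureRecOf T2RecOf WrecOf WrecOf_brefC_of_tableLetters_sym loc_WRem_sym)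
open Summit.QuantumFields.BalabanUV.Beta.WardLocusRecursive (SrecOf)
open Summit.QuantumFields.BalabanUV.Beta.WardLocusCubic (mmSym)
open Summit.QuantumFields.BalabanUV.Beta.SymShiftedSpread (bhKStepSh)
open Summit.QuantumFields.BalabanUV.Beta.BorderedHessian (sgnK bhK stepScale diagK)
open Summit.QuantumFields.BalabanUV.Beta.E3ContactGenerator (ctGenM)
open Summit.QuantumFields.BalabanUV.Beta.DshAn1 (Dsh spr_Dsh)
open Summit.QuantumFields.BalabanUV.Beta.SymAveragingHessianCounts (symVhSAt symHessFFAt symVhSAt_hV0_ctr)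
open Summit.QuantumFields.BalabanUV.Beta.SymTablesAn1FirstOrder (symTablesAn1)
open Summit.QuantumFields.BalabanUV.Beta.RowD1JointEndSymWardTablesAn1 (d1Drift_JsB12Sym_an1Tables_of_bordMixLetters_reflLetters_D1Tel_D1Rep)

namespace Summit.QuantumFields.BalabanUV.Beta.RowD1JointEndSymReflTablesAn1

variable {Lc : ℕ} [NeZero Lc]

/-- **ROW D1 — THE LITERAL ROOT AT an1's FIRST-ORDER SYM TABLES, THE SECOND-ORDER hR LETTER DISCHARGED MODULO TABLE-LEVEL LETTERS**: p273819's
`d1Drift_JsB12Sym_an1Tables_of_bordMixLetters_reflLetters_D1Tel_D1Rep` with `X₂ := diagK X2s`, `Wc := Rm`, `hX₂`, `hWc` and `hWrC` SUPPLIED by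
`SpineRooted.WrecOf_brefC_of_tableLetters_sym` (+ `loc_WRem_sym`); every other binder VERBATIM; `hcomp` stated at `Wc := Rm`.  HONEST: composition by name;
0∕5 root-level classes; NOT D1. -/
theorem d1Drift_JsB12Sym_an1Tables_of_bordMixLetters_reflTableLetters_D1Tel_D1Rep (hLc : Odd Lc) (hL2 : 2 ≤ Lc) {N : ℕ} (hN : 2 ≤ N) (cΛ cB : ℝ)
    -- the two SECOND-ORDER sym tables and their structure letters (LB)(Lmix)(TB)(Tmix) — an1's TABLES-SYM steps S2b+, displayed
    (vh₂S : Fin (3 + 1) → (Fin (3 + 1) → ℤ) → Fin (3 + 1) → (Fin (3 + 1) → ℤ) → MKer (3 + 1) (Fib 3))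
    (mixFF : Fin (3 + 1) → (Fin (3 + 1) → ℤ) → Fin (3 + 1) → (Fin (3 + 1) → ℤ) → MKer (3 + 1) (Fib 3))
    (hB : ∃ C δ : ℝ, 0 < δ ∧ LocStencil₂ vh₂S C δ) (hmix : ∃ C δ : ℝ, 0 < δ ∧ LocStencilFM Lc mixFF C δ)
    (hBt : ∀ (κ : Fin (3 + 1)) (u : Fin (3 + 1) → ℤ) (κ' : Fin (3 + 1)) (u' t : Fin (3 + 1) → ℤ),
      vh₂S κ (u + (Lc : ℤ) • t) κ' (u' + (Lc : ℤ) • t) = shiftK (-((Lc : ℤ) • t)) (vh₂S κ u κ' u'))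
    (hmixt : ∀ (κ : Fin (3 + 1)) (u : Fin (3 + 1) → ℤ) (μ : Fin (3 + 1)) (w t : Fin (3 + 1) → ℤ),
      mixFF κ (u + (Lc : ℤ) • t) μ (w + t) = shiftK (-((Lc : ℤ) • t)) (mixFF κ u μ w))
    -- the second-order TABLE letters' remainders, their classes (one rate per level) and row parities
    (RB RB'' : ℕ → (Fin 4 → ℤ) → Fin 4 → (Fin 4 → ℤ) → MKer 4 (Fib 3))
    (RM : ℕ → (Fin 4 → ℤ) → Fin 4 → (Fin 4 → ℤ) → MKer 4 (Fib 3))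
    (hcls0 : ∃ C δ : ℝ, 0 < δ ∧ (∀ Y, LocStencil (RB 0 Y) C δ) ∧ (∀ Y, LocStencil (RB'' 0 Y) C δ) ∧ (∀ y, VertexFamily (RM 0 y) Lc C δ))
    (hclsS : ∀ j : ℕ, ∃ C δ : ℝ, 0 < δ ∧ (∀ Y, LocStencil (RB (j + 1) Y) C δ) ∧ (∀ Y, LocStencil (RB'' (j + 1) Y) C δ) ∧
      (∀ y, VertexFamily (RM (j + 1) y) Lc C δ))
    (hRBp : ∀ j Y κ u, trK (RB j Y κ u) = -sgnK (RB j Y κ u)) (hRB''p : ∀ j Y κ u, trK (RB'' j Y κ u) = -sgnK (RB'' j Y κ u))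
    (hRMp : ∀ j y ρ' w, trK (RM j y ρ' w) = -sgnK (RM j y ρ' w))
    -- (T2-B) the Ward law of the second-order border table `vh₂S` against an1's `symVhSAt ρ_c`, both slots, level 0 and level j+1
    (hBord0 : ∀ (Y : Fin 4 → ℤ) (κ' : Fin 4) (u' : Fin 4 → ℤ),
      (stepScale 3 Lc 0 * (Lc : ℝ) ^ (3 + 1))⁻¹ • ∑ v ∈ box (3 + 1) Lc, divV (fun κ u => cB • vh₂S κ u κ' u') ((Lc : ℤ) • Y + toSite v) =
        comp ((-((Lc : ℝ) ^ (3 + 1) * (1 / 2) * (Lc : ℝ) ^ (3 + 1))) • symVhSAt (ctr 4 Lc) 3 Lc rfl κ' u')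
            (diagK ((1 / 2 : ℝ) • ∑ v ∈ box (3 + 1) Lc, legInd (ctr (3 + 1) Lc) ((Lc : ℤ) • Y + toSite v)))
          - comp (diagK ((1 / 2 : ℝ) • ∑ v ∈ box (3 + 1) Lc, legInd (ctr (3 + 1) Lc) ((Lc : ℤ) • Y + toSite v)))
            ((-((Lc : ℝ) ^ (3 + 1) * (1 / 2) * (Lc : ℝ) ^ (3 + 1))) • symVhSAt (ctr 4 Lc) 3 Lc rfl κ' u') + RB 0 Y κ' u')
    (hBord0'' : ∀ (Y : Fin 4 → ℤ) (κ : Fin 4) (u : Fin 4 → ℤ),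
      (stepScale 3 Lc 0 * (Lc : ℝ) ^ (3 + 1))⁻¹ • ∑ v ∈ box (3 + 1) Lc, divV (fun κ' u' => cB • vh₂S κ u κ' u') ((Lc : ℤ) • Y + toSite v) =
        comp ((-((Lc : ℝ) ^ (3 + 1) * (1 / 2) * (Lc : ℝ) ^ (3 + 1))) • symVhSAt (ctr 4 Lc) 3 Lc rfl κ u)
            (diagK ((1 / 2 : ℝ) • ∑ v ∈ box (3 + 1) Lc, legInd (ctr (3 + 1) Lc) ((Lc : ℤ) • Y + toSite v)))
          - comp (diagK ((1 / 2 : ℝ) • ∑ v ∈ box (3 + 1) Lc, legInd (ctr (3 + 1) Lc) ((Lc : ℤ) • Y + toSite v)))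
            ((-((Lc : ℝ) ^ (3 + 1) * (1 / 2) * (Lc : ℝ) ^ (3 + 1))) • symVhSAt (ctr 4 Lc) 3 Lc rfl κ u) + RB'' 0 Y κ u)
    (hBordS : ∀ (j : ℕ) (Y : Fin 4 → ℤ) (κ' : Fin 4) (u' : Fin 4 → ℤ),
      (stepScale 3 Lc (j + 1) * (Lc : ℝ) ^ (3 + 1))⁻¹ • ∑ v ∈ box (3 + 1) Lc, divV (fun κ u => (cB * wB2 3 Lc (j + 1)) • vh₂S κ u κ' u') ((Lc : ℤ) • Y + toSite v) =
        comp (((-((Lc : ℝ) ^ (3 + 1) * (1 / 2) * (Lc : ℝ) ^ (3 + 1))) * wVH 3 Lc (j + 1)) • symVhSAt (ctr 4 Lc) 3 Lc rfl κ' u')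
            (diagK ((1 / 2 : ℝ) • ∑ v ∈ box (3 + 1) Lc, legInd (ctr (3 + 1) Lc) ((Lc : ℤ) • Y + toSite v)))
          - comp (diagK ((1 / 2 : ℝ) • ∑ v ∈ box (3 + 1) Lc, legInd (ctr (3 + 1) Lc) ((Lc : ℤ) • Y + toSite v)))
            (((-((Lc : ℝ) ^ (3 + 1) * (1 / 2) * (Lc : ℝ) ^ (3 + 1))) * wVH 3 Lc (j + 1)) • symVhSAt (ctr 4 Lc) 3 Lc rfl κ' u') + RB (j + 1) Y κ' u')
    (hBordS'' : ∀ (j : ℕ) (Y : Fin 4 → ℤ) (κ : Fin 4) (u : Fin 4 → ℤ),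
      (stepScale 3 Lc (j + 1) * (Lc : ℝ) ^ (3 + 1))⁻¹ • ∑ v ∈ box (3 + 1) Lc, divV (fun κ' u' => (cB * wB2 3 Lc (j + 1)) • vh₂S κ u κ' u') ((Lc : ℤ) • Y + toSite v) =
        comp (((-((Lc : ℝ) ^ (3 + 1) * (1 / 2) * (Lc : ℝ) ^ (3 + 1))) * wVH 3 Lc (j + 1)) • symVhSAt (ctr 4 Lc) 3 Lc rfl κ u)
            (diagK ((1 / 2 : ℝ) • ∑ v ∈ box (3 + 1) Lc, legInd (ctr (3 + 1) Lc) ((Lc : ℤ) • Y + toSite v)))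
          - comp (diagK ((1 / 2 : ℝ) • ∑ v ∈ box (3 + 1) Lc, legInd (ctr (3 + 1) Lc) ((Lc : ℤ) • Y + toSite v)))
            (((-((Lc : ℝ) ^ (3 + 1) * (1 / 2) * (Lc : ℝ) ^ (3 + 1))) * wVH 3 Lc (j + 1)) • symVhSAt (ctr 4 Lc) 3 Lc rfl κ u) + RB'' (j + 1) Y κ u)
    -- (T2-M₂) the Ward law of the mixed table `M2Of 3 Lc mixFF j` against `M1Of 3 Lc (symHessFFAt ρ_c Lc) cΛ j`, every level
    (hM₂ : ∀ (j : ℕ) (y : Fin 4 → ℤ) (ρ' : Fin 4) (w : Fin 4 → ℤ),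
      (stepScale 3 Lc j * (Lc : ℝ) ^ (3 + 1))⁻¹ • ∑ v ∈ box (3 + 1) Lc, divV (fun κ u => M2Of 3 Lc mixFF j κ u ρ' w) ((Lc : ℤ) • y + toSite v) =
        comp (M1Of 3 Lc (symHessFFAt (ctr 4 Lc) Lc) cΛ j ρ' w) (diagK ((1 / 2 : ℝ) • ∑ v ∈ box (3 + 1) Lc, legInd (ctr (3 + 1) Lc) ((Lc : ℤ) • y + toSite v)))
          - comp (diagK ((1 / 2 : ℝ) • ∑ v ∈ box (3 + 1) Lc, legInd (ctr (3 + 1) Lc) ((Lc : ℤ) • y + toSite v))) (M1Of 3 Lc (symHessFFAt (ctr 4 Lc) Lc) cΛ j ρ' w)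
          + RM j y ρ' w)
    -- hR, first order: the REFLECTION letters (V-r)(H-r) of an1's concrete first-order sym tables (pinned contact generator) — an1's reflection step, displayed
    (hVfm : ∀ (α κ' : Fin 4) (u x z : Fin 4 → ℤ) (β m : Fin 4), symVhSAt (ctr 4 Lc) 3 Lc rfl κ' (bref α κ' u) x z (Sum.inl β) (Sum.inr m) =
      (reflSign α κ' • refK (Φ (d := 3) Lc α) (symVhSAt (ctr 4 Lc) 3 Lc rfl κ' u + conjV (bhK (d := 3) Lc + Dsh Lc)
        ((((Lc : ℝ) ^ 4)⁻¹) • diagK (ctGenM 3 (bhK Lc + Dsh Lc) α Lc κ' u)))) x z (Sum.inl β) (Sum.inr m))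
    (hVmf : ∀ (α κ' : Fin 4) (u x z : Fin 4 → ℤ) (m β : Fin 4), symVhSAt (ctr 4 Lc) 3 Lc rfl κ' (bref α κ' u) x z (Sum.inr m) (Sum.inl β) =
      (reflSign α κ' • refK (Φ (d := 3) Lc α) (symVhSAt (ctr 4 Lc) 3 Lc rfl κ' u + conjV (bhK (d := 3) Lc + Dsh Lc)
        ((((Lc : ℝ) ^ 4)⁻¹) • diagK (ctGenM 3 (bhK Lc + Dsh Lc) α Lc κ' u)))) x z (Sum.inr m) (Sum.inl β))
    (hVmm : ∀ (α κ' : Fin 4) (u x z : Fin 4 → ℤ) (m m' : Fin 4), symVhSAt (ctr 4 Lc) 3 Lc rfl κ' (bref α κ' u) x z (Sum.inr m) (Sum.inr m') =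
      (reflSign α κ' • refK (Φ (d := 3) Lc α) (symVhSAt (ctr 4 Lc) 3 Lc rfl κ' u + conjV (bhK (d := 3) Lc + Dsh Lc)
        ((((Lc : ℝ) ^ 4)⁻¹) • diagK (ctGenM 3 (bhK Lc + Dsh Lc) α Lc κ' u)))) x z (Sum.inr m) (Sum.inr m'))
    (hHr : ∀ (α μ : Fin 4) (y : Fin 4 → ℤ),
      symHessFFAt (ctr 4 Lc) Lc μ (bref α μ y) = reflSign α μ • refK (Φ (d := 3) Lc α) (symHessFFAt (ctr 4 Lc) Lc μ y))
    -- the first-order contact coefficient, displayed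
    (γ : ℕ → ℝ) (hγ : ∀ j, γ j = -((Lc : ℝ) ^ 8 / 2) * wVH 3 Lc j / (stepScale 3 Lc j * (Lc : ℝ) ^ 4))
    -- hR, SECOND ORDER, NOW TABLE-LEVEL: (hB0) the border table's zero field block, the second units lock, and the second-order TABLE reflection letters
    -- (level-0 letter, mixed letter ∀ j, border letter ∀ j+1), the mechanical split identities + localisations, the remainder recursion (with the four
    -- inner sandwich-defect words of `SecondOrderInverseShapeDefect.K3_sharp_defect`) — the hypotheses of `SpineRooted.WrecOf_brefC_of_tableLetters_sym`
    (hB0 : ∀ κ u κ' u' (x z : Fin 4 → ℤ) (β β' : Fin 4), vh₂S κ u κ' u' x z (Sum.inl β) (Sum.inl β') = 0)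
    (hlock2 : ∀ j, ((Lc : ℝ) ^ 8) * wV4 3 Lc (j + 1) * wVH 3 Lc (j + 1) = ((Lc : ℝ) ^ 4 * wE 3 Lc (j + 1)) ^ 2)
    (h2 : ℕ → Fin 4 → Fin 4 → (Fin 4 → ℤ) → Fin 4 → (Fin 4 → ℤ) → (Fin 4 → ℤ) → Fib 3 → ℝ)
    (R2 : ℕ → Fin 4 → Fin 4 → (Fin 4 → ℤ) → Fin 4 → (Fin 4 → ℤ) → MKer 4 (Fib 3))
    (RMr : ℕ → Fin 4 → Fin 4 → (Fin 4 → ℤ) → Fin 4 → (Fin 4 → ℤ) → MKer 4 (Fib 3))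
    (h0 : ∀ (α κ : Fin 4) (u : Fin 4 → ℤ) (κ' : Fin 4) (u' : Fin 4 → ℤ),
      T2RecOf 3 Lc (Gsym Lc) (SpureRecOf 3 Lc (symVhSAt (ctr 4 Lc) 3 Lc rfl) (symHessFFAt (ctr 4 Lc) Lc) (Gsym Lc) ((Lc : ℝ) ^ 4) (-((Lc : ℝ) ^ 8 / 2)) cΛ) (M1Of 3 Lc (symHessFFAt (ctr 4 Lc) Lc) cΛ) ((Lc : ℝ) ^ 8) cB ((8 * (N : ℝ) ^ 2)⁻¹ • wsym22 N) vh₂S mixFF 0 κ (bref α κ u) κ' (bref α κ' u') =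
        (reflSign α κ * reflSign α κ') • refK (Φ Lc α)
          (T2RecOf 3 Lc (Gsym Lc) (SpureRecOf 3 Lc (symVhSAt (ctr 4 Lc) 3 Lc rfl) (symHessFFAt (ctr 4 Lc) Lc) (Gsym Lc) ((Lc : ℝ) ^ 4) (-((Lc : ℝ) ^ 8 / 2)) cΛ) (M1Of 3 Lc (symHessFFAt (ctr 4 Lc) Lc) cΛ) ((Lc : ℝ) ^ 8) cB ((8 * (N : ℝ) ^ 2)⁻¹ • wsym22 N) vh₂S mixFF 0 κ u κ' u' +
            conjW (bhKStepSh 3 Lc (Dsh Lc) 0) (SpureRecOf 3 Lc (symVhSAt (ctr 4 Lc) 3 Lc rfl) (symHessFFAt (ctr 4 Lc) Lc) (Gsym Lc) ((Lc : ℝ) ^ 4) (-((Lc : ℝ) ^ 8 / 2)) cΛ 0 κ u) (SpureRecOf 3 Lc (symVhSAt (ctr 4 Lc) 3 Lc rfl) (symHessFFAt (ctr 4 Lc) Lc) (Gsym Lc) ((Lc : ℝ) ^ 4) (-((Lc : ℝ) ^ 8 / 2)) cΛ 0 κ' u')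
              (diagK fun p c => γ 0 * ctGenM 3 (bhK Lc + Dsh Lc) α Lc κ u p c) (diagK fun p c => γ 0 * ctGenM 3 (bhK Lc + Dsh Lc) α Lc κ' u' p c) (diagK (h2 0 α κ u κ' u')) +
            R2 0 α κ u κ' u'))
    (hM2 : ∀ (j : ℕ) (α κ : Fin 4) (u : Fin 4 → ℤ) (ρ : Fin 4) (w : Fin 4 → ℤ),
      M2Of 3 Lc mixFF j κ (bref α κ u) ρ (bref α ρ w) =
        (reflSign α κ * reflSign α ρ) • refK (Φ Lc α)
          (M2Of 3 Lc mixFF j κ u ρ w + conjV (M1Of 3 Lc (symHessFFAt (ctr 4 Lc) Lc) cΛ j ρ w) (diagK fun p c => γ j * ctGenM 3 (bhK Lc + Dsh Lc) α Lc κ u p c) + RMr j α κ u ρ w))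
    (X2s : ℕ → Fin 4 → Fin 4 → (Fin 4 → ℤ) → Fin 4 → (Fin 4 → ℤ) → (Fin 4 → ℤ) → Fib 3 → ℝ)
    (Δ : ℕ → Fin 4 → Fin 4 → (Fin 4 → ℤ) → Fin 4 → (Fin 4 → ℤ) → MKer 4 (Fib 3))
    (hsplit : ∀ (j : ℕ) (α μ : Fin 4) (y : Fin 4 → ℤ) (ν : Fin 4) (y' : Fin 4 → ℤ),
      W2OfK (Gsym (d := 3) Lc j) Lc
          (fun κ u => SpureRecOf 3 Lc (symVhSAt (ctr 4 Lc) 3 Lc rfl) (symHessFFAt (ctr 4 Lc) Lc) (Gsym Lc) ((Lc : ℝ) ^ 4) (-((Lc : ℝ) ^ 8 / 2)) cΛ j κ u + conjV (bhKStepSh 3 Lc (Dsh Lc) j) (diagK fun p c => γ j * ctGenM 3 (bhK Lc + Dsh Lc) α Lc κ u p c))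
          (M1Of 3 Lc (symHessFFAt (ctr 4 Lc) Lc) cΛ j)
          (fun κ u κ' u' => T2RecOf 3 Lc (Gsym Lc) (SpureRecOf 3 Lc (symVhSAt (ctr 4 Lc) 3 Lc rfl) (symHessFFAt (ctr 4 Lc) Lc) (Gsym Lc) ((Lc : ℝ) ^ 4) (-((Lc : ℝ) ^ 8 / 2)) cΛ) (M1Of 3 Lc (symHessFFAt (ctr 4 Lc) Lc) cΛ) ((Lc : ℝ) ^ 8) cB ((8 * (N : ℝ) ^ 2)⁻¹ • wsym22 N) vh₂S mixFF j κ u κ' u' +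
            conjW (bhKStepSh 3 Lc (Dsh Lc) j) (SpureRecOf 3 Lc (symVhSAt (ctr 4 Lc) 3 Lc rfl) (symHessFFAt (ctr 4 Lc) Lc) (Gsym Lc) ((Lc : ℝ) ^ 4) (-((Lc : ℝ) ^ 8 / 2)) cΛ j κ u) (SpureRecOf 3 Lc (symVhSAt (ctr 4 Lc) 3 Lc rfl) (symHessFFAt (ctr 4 Lc) Lc) (Gsym Lc) ((Lc : ℝ) ^ 4) (-((Lc : ℝ) ^ 8 / 2)) cΛ j κ' u')
              (diagK fun p c => γ j * ctGenM 3 (bhK Lc + Dsh Lc) α Lc κ u p c) (diagK fun p c => γ j * ctGenM 3 (bhK Lc + Dsh Lc) α Lc κ' u' p c) (diagK (h2 j α κ u κ' u')) +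
            R2 j α κ u κ' u')
          (fun κ u ρ w => M2Of 3 Lc mixFF j κ u ρ w + conjV (M1Of 3 Lc (symHessFFAt (ctr 4 Lc) Lc) cΛ j ρ w) (diagK fun p c => γ j * ctGenM 3 (bhK Lc + Dsh Lc) α Lc κ u p c) + RMr j α κ u ρ w)
          μ y ν y' =
        W2OfK (Gsym (d := 3) Lc j) Lc (SpureRecOf 3 Lc (symVhSAt (ctr 4 Lc) 3 Lc rfl) (symHessFFAt (ctr 4 Lc) Lc) (Gsym Lc) ((Lc : ℝ) ^ 4) (-((Lc : ℝ) ^ 8 / 2)) cΛ j) (M1Of 3 Lc (symHessFFAt (ctr 4 Lc) Lc) cΛ j)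
            (T2RecOf 3 Lc (Gsym Lc) (SpureRecOf 3 Lc (symVhSAt (ctr 4 Lc) 3 Lc rfl) (symHessFFAt (ctr 4 Lc) Lc) (Gsym Lc) ((Lc : ℝ) ^ 4) (-((Lc : ℝ) ^ 8 / 2)) cΛ) (M1Of 3 Lc (symHessFFAt (ctr 4 Lc) Lc) cΛ) ((Lc : ℝ) ^ 8) cB ((8 * (N : ℝ) ^ 2)⁻¹ • wsym22 N) vh₂S mixFF j)
            (M2Of 3 Lc mixFF j) μ y ν y' +
          conjW (bhKStepSh 3 Lc (Dsh Lc) j)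
            (dM (Gsym Lc j) Lc (SpureRecOf 3 Lc (symVhSAt (ctr 4 Lc) 3 Lc rfl) (symHessFFAt (ctr 4 Lc) Lc) (Gsym Lc) ((Lc : ℝ) ^ 4) (-((Lc : ℝ) ^ 8 / 2)) cΛ j) (M1Of 3 Lc (symHessFFAt (ctr 4 Lc) Lc) cΛ j) μ y)
            (dM (Gsym Lc j) Lc (SpureRecOf 3 Lc (symVhSAt (ctr 4 Lc) 3 Lc rfl) (symHessFFAt (ctr 4 Lc) Lc) (Gsym Lc) ((Lc : ℝ) ^ 4) (-((Lc : ℝ) ^ 8 / 2)) cΛ j) (M1Of 3 Lc (symHessFFAt (ctr 4 Lc) Lc) cΛ j) ν y')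
            (diagK fun p c => ∑ κ, ∑' u, colH (Gsym Lc j) Lc μ y κ u * (γ j * ctGenM 3 (bhK Lc + Dsh Lc) α Lc κ u p c))
            (diagK fun p c => ∑ κ, ∑' u, colH (Gsym Lc j) Lc ν y' κ u * (γ j * ctGenM 3 (bhK Lc + Dsh Lc) α Lc κ u p c))
            (diagK (X2s j α μ y ν y')) +
          Δ j α μ y ν y')
    (hDg : ∀ (j : ℕ) (α ν : Fin 4) (y' : Fin 4 → ℤ),
      Loc (dM (Gsym (d := 3) Lc j) Lc (fun κ u => SpureRecOf 3 Lc (symVhSAt (ctr 4 Lc) 3 Lc rfl) (symHessFFAt (ctr 4 Lc) Lc) (Gsym Lc) ((Lc : ℝ) ^ 4) (-((Lc : ℝ) ^ 8 / 2)) cΛ j κ u + conjV (bhKStepSh 3 Lc (Dsh Lc) j) (diagK fun p c => γ j * ctGenM 3 (bhK Lc + Dsh Lc) α Lc κ u p c)) (M1Of 3 Lc (symHessFFAt (ctr 4 Lc) Lc) cΛ j) ν y'))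
    (hX2L : ∀ j α μ y ν y', Loc (diagK (X2s j α μ y ν y'))) (hΔL : ∀ j α μ y ν y', Loc (Δ j α μ y ν y'))
    (RBr : ℕ → Fin 4 → Fin 4 → (Fin 4 → ℤ) → Fin 4 → (Fin 4 → ℤ) → MKer 4 (Fib 3))
    (hRBrff : ∀ j α κ u κ' u' (x z : Fin 4 → ℤ) (β β' : Fin 4), RBr j α κ u κ' u' x z (Sum.inl β) (Sum.inl β') = 0)
    (hBfm : ∀ (j : ℕ) (α : Fin 4) κ u κ' u' (x z : Fin 4 → ℤ) (β m : Fin 4),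
      ((cB * wB2 3 Lc (j + 1)) • vh₂S κ (bref α κ u) κ' (bref α κ' u')) x z (Sum.inl β) (Sum.inr m) =
        ((reflSign α κ * reflSign α κ') • refK (Φ Lc α) ((cB * wB2 3 Lc (j + 1)) • vh₂S κ u κ' u' +
          conjW (bhKStepSh 3 Lc (Dsh Lc) (j + 1)) (SpureRecOf 3 Lc (symVhSAt (ctr 4 Lc) 3 Lc rfl) (symHessFFAt (ctr 4 Lc) Lc) (Gsym Lc) ((Lc : ℝ) ^ 4) (-((Lc : ℝ) ^ 8 / 2)) cΛ (j + 1) κ u) (SpureRecOf 3 Lc (symVhSAt (ctr 4 Lc) 3 Lc rfl) (symHessFFAt (ctr 4 Lc) Lc) (Gsym Lc) ((Lc : ℝ) ^ 4) (-((Lc : ℝ) ^ 8 / 2)) cΛ (j + 1) κ' u')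
            (diagK fun p c => γ (j + 1) * ctGenM 3 (bhK Lc + Dsh Lc) α Lc κ u p c) (diagK fun p c => γ (j + 1) * ctGenM 3 (bhK Lc + Dsh Lc) α Lc κ' u' p c)
            (diagK (h2 (j + 1) α κ u κ' u')) + RBr (j + 1) α κ u κ' u')) x z (Sum.inl β) (Sum.inr m))
    (hBmf : ∀ (j : ℕ) (α : Fin 4) κ u κ' u' (x z : Fin 4 → ℤ) (m β : Fin 4),
      ((cB * wB2 3 Lc (j + 1)) • vh₂S κ (bref α κ u) κ' (bref α κ' u')) x z (Sum.inr m) (Sum.inl β) =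
        ((reflSign α κ * reflSign α κ') • refK (Φ Lc α) ((cB * wB2 3 Lc (j + 1)) • vh₂S κ u κ' u' +
          conjW (bhKStepSh 3 Lc (Dsh Lc) (j + 1)) (SpureRecOf 3 Lc (symVhSAt (ctr 4 Lc) 3 Lc rfl) (symHessFFAt (ctr 4 Lc) Lc) (Gsym Lc) ((Lc : ℝ) ^ 4) (-((Lc : ℝ) ^ 8 / 2)) cΛ (j + 1) κ u) (SpureRecOf 3 Lc (symVhSAt (ctr 4 Lc) 3 Lc rfl) (symHessFFAt (ctr 4 Lc) Lc) (Gsym Lc) ((Lc : ℝ) ^ 4) (-((Lc : ℝ) ^ 8 / 2)) cΛ (j + 1) κ' u')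
            (diagK fun p c => γ (j + 1) * ctGenM 3 (bhK Lc + Dsh Lc) α Lc κ u p c) (diagK fun p c => γ (j + 1) * ctGenM 3 (bhK Lc + Dsh Lc) α Lc κ' u' p c)
            (diagK (h2 (j + 1) α κ u κ' u')) + RBr (j + 1) α κ u κ' u')) x z (Sum.inr m) (Sum.inl β))
    (hBmm : ∀ (j : ℕ) (α : Fin 4) κ u κ' u' (x z : Fin 4 → ℤ) (m m' : Fin 4),
      ((cB * wB2 3 Lc (j + 1)) • vh₂S κ (bref α κ u) κ' (bref α κ' u')) x z (Sum.inr m) (Sum.inr m') =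
        ((reflSign α κ * reflSign α κ') • refK (Φ Lc α) ((cB * wB2 3 Lc (j + 1)) • vh₂S κ u κ' u' +
          conjW (bhKStepSh 3 Lc (Dsh Lc) (j + 1)) (SpureRecOf 3 Lc (symVhSAt (ctr 4 Lc) 3 Lc rfl) (symHessFFAt (ctr 4 Lc) Lc) (Gsym Lc) ((Lc : ℝ) ^ 4) (-((Lc : ℝ) ^ 8 / 2)) cΛ (j + 1) κ u) (SpureRecOf 3 Lc (symVhSAt (ctr 4 Lc) 3 Lc rfl) (symHessFFAt (ctr 4 Lc) Lc) (Gsym Lc) ((Lc : ℝ) ^ 4) (-((Lc : ℝ) ^ 8 / 2)) cΛ (j + 1) κ' u')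
            (diagK fun p c => γ (j + 1) * ctGenM 3 (bhK Lc + Dsh Lc) α Lc κ u p c) (diagK fun p c => γ (j + 1) * ctGenM 3 (bhK Lc + Dsh Lc) α Lc κ' u' p c)
            (diagK (h2 (j + 1) α κ u κ' u')) + RBr (j + 1) α κ u κ' u')) x z (Sum.inr m) (Sum.inr m'))
    (hR2succ : ∀ (j : ℕ) (α κ : Fin 4) (u : Fin 4 → ℤ) (κ' : Fin 4) (u' : Fin 4 → ℤ),
      R2 (j + 1) α κ u κ' u' =
          (-((((Lc : ℝ) ^ 8) * wV4 3 Lc (j + 1)) • mmRead Lc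
              (comp (comp (Gsym Lc j) (((1 / 2 : ℝ) • conjV (bhKStepSh 3 Lc (Dsh Lc) j) (diagK fun p a => X2s j α κ' u' κ u p a - X2s j α κ u κ' u' p a) +
                (1 / 2 : ℝ) • (Δ j α κ u κ' u' + Δ j α κ' u' κ u)))) (Gsym Lc j) -
                (comp (sandwichDefect (Gsym Lc j) (bhKStepSh 3 Lc (Dsh Lc) j)
                      (diagK fun p c => ∑ ι, ∑' v, colH (Gsym Lc j) Lc κ u ι v * (γ j * ctGenM 3 (bhK Lc + Dsh Lc) α Lc ι v p c)))
                    (comp (dM (Gsym Lc j) Lc (SpureRecOf 3 Lc (symVhSAt (ctr 4 Lc) 3 Lc rfl) (symHessFFAt (ctr 4 Lc) Lc) (Gsym Lc) ((Lc : ℝ) ^ 4) (-((Lc : ℝ) ^ 8 / 2)) cΛ j) (M1Of 3 Lc (symHessFFAt (ctr 4 Lc) Lc) cΛ j) κ' u') (Gsym Lc j) -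
                      diagK fun p c => ∑ ι, ∑' v, colH (Gsym Lc j) Lc κ' u' ι v * (γ j * ctGenM 3 (bhK Lc + Dsh Lc) α Lc ι v p c))
                  + comp (comp (Gsym Lc j) (dM (Gsym Lc j) Lc (SpureRecOf 3 Lc (symVhSAt (ctr 4 Lc) 3 Lc rfl) (symHessFFAt (ctr 4 Lc) Lc) (Gsym Lc) ((Lc : ℝ) ^ 4) (-((Lc : ℝ) ^ 8 / 2)) cΛ j) (M1Of 3 Lc (symHessFFAt (ctr 4 Lc) Lc) cΛ j) κ u +
                      conjV (bhKStepSh 3 Lc (Dsh Lc) j) (diagK fun p c => ∑ ι, ∑' v, colH (Gsym Lc j) Lc κ u ι v * (γ j * ctGenM 3 (bhK Lc + Dsh Lc) α Lc ι v p c))))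
                    (sandwichDefect (Gsym Lc j) (bhKStepSh 3 Lc (Dsh Lc) j)
                      (diagK fun p c => ∑ ι, ∑' v, colH (Gsym Lc j) Lc κ' u' ι v * (γ j * ctGenM 3 (bhK Lc + Dsh Lc) α Lc ι v p c)))
                  + comp (sandwichDefect (Gsym Lc j) (bhKStepSh 3 Lc (Dsh Lc) j)
                      (diagK fun p c => ∑ ι, ∑' v, colH (Gsym Lc j) Lc κ' u' ι v * (γ j * ctGenM 3 (bhK Lc + Dsh Lc) α Lc ι v p c)))
                    (comp (dM (Gsym Lc j) Lc (SpureRecOf 3 Lc (symVhSAt (ctr 4 Lc) 3 Lc rfl) (symHessFFAt (ctr 4 Lc) Lc) (Gsym Lc) ((Lc : ℝ) ^ 4) (-((Lc : ℝ) ^ 8 / 2)) cΛ j) (M1Of 3 Lc (symHessFFAt (ctr 4 Lc) Lc) cΛ j) κ u) (Gsym Lc j) -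
                      diagK fun p c => ∑ ι, ∑' v, colH (Gsym Lc j) Lc κ u ι v * (γ j * ctGenM 3 (bhK Lc + Dsh Lc) α Lc ι v p c))
                  + comp (comp (Gsym Lc j) (dM (Gsym Lc j) Lc (SpureRecOf 3 Lc (symVhSAt (ctr 4 Lc) 3 Lc rfl) (symHessFFAt (ctr 4 Lc) Lc) (Gsym Lc) ((Lc : ℝ) ^ 4) (-((Lc : ℝ) ^ 8 / 2)) cΛ j) (M1Of 3 Lc (symHessFFAt (ctr 4 Lc) Lc) cΛ j) κ' u' +
                      conjV (bhKStepSh 3 Lc (Dsh Lc) j) (diagK fun p c => ∑ ι, ∑' v, colH (Gsym Lc j) Lc κ' u' ι v * (γ j * ctGenM 3 (bhK Lc + Dsh Lc) α Lc ι v p c))))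
                    (sandwichDefect (Gsym Lc j) (bhKStepSh 3 Lc (Dsh Lc) j)
                      (diagK fun p c => ∑ ι, ∑' v, colH (Gsym Lc j) Lc κ u ι v * (γ j * ctGenM 3 (bhK Lc + Dsh Lc) α Lc ι v p c)))))) +
            RBr (j + 1) α κ u κ' u' +
            conjV (mmRead Lc (Gsym (d := 3) Lc j))
              (diagK fun p c => ((Lc : ℝ) ^ 8) * wV4 3 Lc (j + 1) * mmSym Lc (X2s j α κ u κ' u') p c - wVH 3 Lc (j + 1) * h2 (j + 1) α κ u κ' u' p c)))
    -- the cancellation of the chart-(II) defect against the W-REMAINDER `Rm_j` (the compensator is now IDENTIFIED: `Wc := Rm`, `X₂ := diagK X2s`) — the (N8) object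
    (hcomp : ∀ (j : ℕ) (α μ : Fin 4) (y : Fin 4 → ℤ) (ν : Fin 4) (y' : Fin 4 → ℤ),
      (1 / 2 : ℝ) * tadpole (coDressKSymAt (toSite (ctrOff 4 Lc)) Lc (KInvStep (d := 3) Lc j))
        ((1 / 2 : ℝ) • conjV (bhKStepSh 3 Lc (Dsh Lc) j) (diagK fun p a => X2s j α ν y' μ y p a - X2s j α μ y ν y' p a) +
          (1 / 2 : ℝ) • (Δ j α μ y ν y' + Δ j α ν y' μ y))
        + conjDefect (coDressKSymAt (toSite (ctrOff 4 Lc)) Lc (KInvStep (d := 3) Lc j)) (bhKStepSh 3 Lc (Dsh Lc) j)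
            (vertexOfK (coDressKSymAt (toSite (ctrOff 4 Lc)) Lc (KInvStep (d := 3) Lc j)) Lc (JsB12Sym0 hLc N (symTablesAn1 3 Lc cΛ vh₂S mixFF hB hmix hBt hmixt) cΛ cB j).S μ y)
            (vertexOfK (coDressKSymAt (toSite (ctrOff 4 Lc)) Lc (KInvStep (d := 3) Lc j)) Lc (JsB12Sym0 hLc N (symTablesAn1 3 Lc cΛ vh₂S mixFF hB hmix hBt hmixt) cΛ cB j).S ν y')
            (vertexOfK (coDressKSymAt (toSite (ctrOff 4 Lc)) Lc (KInvStep (d := 3) Lc j)) Lc (fun κ u => γ j • diagK (ctGenM 3 (bhK Lc + Dsh Lc) α Lc κ u)) μ y)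
            (vertexOfK (coDressKSymAt (toSite (ctrOff 4 Lc)) Lc (KInvStep (d := 3) Lc j)) Lc (fun κ u => γ j • diagK (ctGenM 3 (bhK Lc + Dsh Lc) α Lc κ u)) ν y')
            (diagK (X2s j α μ y ν y')) = 0)
    -- the route theorem's own binders, verbatim
    (a : ℝ) (ha : 0 < a)
    (h12 : B5.Prop12Printed (fam (fun i : ℕ+ × ℕ => ((i.1 : ℕ+) : ℕ)) (fun i => i.1.pos) MvE a ha))
    (h126 : B5.Kernel126_127Printed (kfam (fun i : ℕ+ × ℕ => ((i.1 : ℕ+) : ℕ)) MvE))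
    {L : Type*} {SL : Finset L} (hSL : SL.Nonempty) (k : L → Fin 4) {μ ν : Fin 4} (hμν : μ ≠ ν) {Nc : ℝ} (hNc : Nc ≠ 0)
    (Jc : ∀ m : ℕ, JetData 3 (Lc ^ m))
    (htel : D1Tel Lc (JsB12Sym hLc N (symTablesAn1 3 Lc cΛ vh₂S mixFF hB hmix hBt hmixt) cΛ cB) Jc)
    {cc : ℝ} {Mw' : ℕ → ℕ} (hc : 1 ≤ cc) (hMwin : ∀ L : ℕ, 2 ≤ L → 1 ≤ Mw' L ∧ (L : ℝ) ≤ cc * Mw' L) (hML : ∀ L : ℕ, 2 ≤ L → Mw' L ≤ L)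
    (hrep : D1Rep Lc Jc Nc μ ν a SL k) :
    D1Drift Lc (JsB12Sym hLc N (symTablesAn1 3 Lc cΛ vh₂S mixFF hB hmix hBt hmixt) cΛ cB) Nc μ ν := by
  have hL1 : 1 ≤ Lc := one_le_of_neZero Lc
  have hWr := WrecOf_brefC_of_tableLetters_sym hLc (symTablesAn1 3 Lc cΛ vh₂S mixFF hB hmix hBt hmixt) cΛ ((Lc : ℝ) ^ 8) cB ((8 * (N : ℝ) ^ 2)⁻¹ • wsym22 N)
    hVfm hVmf hVmm (symVhSAt_hV0_ctr Lc) hHr hB0 γ hγ hlock2 h2 R2 RMr h0 hM2 X2s Δ hsplit hDg hX2L hΔL RBr hRBrff hBfm hBmf hBmm hR2succ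
  exact d1Drift_JsB12Sym_an1Tables_of_bordMixLetters_reflLetters_D1Tel_D1Rep hLc hL2 hN cΛ cB vh₂S mixFF hB hmix hBt hmixt RB RB'' RM hcls0 hclsS
    hRBp hRB''p hRMp hBord0 hBord0'' hBordS hBordS'' hM₂ hVfm hVmf hVmm hHr γ hγ
    (fun j α μ y ν y' => diagK (X2s j α μ y ν y'))
    (fun j α μ y ν y' => (1 / 2 : ℝ) • conjV (bhKStepSh 3 Lc (Dsh Lc) j) (diagK fun p a => X2s j α ν y' μ y p a - X2s j α μ y ν y' p a) +
      (1 / 2 : ℝ) • (Δ j α μ y ν y' + Δ j α ν y' μ y))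
    (fun j α μ y ν y' => hX2L j α μ y ν y') (fun j α μ y ν y' => loc_WRem_sym (d := 3) (spr_Dsh hL1) (hX2L j α) (hΔL j α) μ y ν y')
    (fun j α μ y ν y' => hWr j α μ y ν y') hcomp a ha h12 h126 hSL k hμν hNc Jc htel hc hMwin hML hrep

end Summit.QuantumFields.BalabanUV.Beta.RowD1JointEndSymReflTablesAn1

end
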